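import Summits.Ventures.DiscreteObjects.PP12.FlagTenLatinSquare

/-!
# PP(12), flag sub-cell `f = 10`: the ORBIT MATRIX as a typed finite statement
Framing: lottery ticket; floor = certified bounds/negative ranges.

Cell pub-namedobj (venture DiscreteObjects), target (M), designs gen 12. A flag-type collineation `σ` (`σ³ = 1`) of a projective plane
of order 12 with exactly 10 fixed points `c, y₁, …, y₉ ∈ l` (fixed lines `l, m₁, …, m₉ ∋ c`) has 49 non-trivial point orbits and 49
non-trivial line orbits of size 3; its `59 × 59` orbit matrix (tactical decomposition) is determined by the following finite data on the
12 exterior orbit-triangles (`Fin 12`), the 9 fixed points `y_k` / fixed lines `m_j` (`Fin 9`) and the 4 non-trivial orbits on each `m_j`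
resp. through each `y_k` (`Fin 4`):
* `φ : Perm (Fin 12)` — triangle `i` is inscribed in triangle `φ i` (the odd-point permutation of `FlagTenOddPoint` is `φ⁻¹` on orbits);
* `γ j : Fin 12 → Fin 4` — the orbit on `m_j` met by the sides of triangle `i` (LINE side; fibres = a triangle factor of `K₁₂ − C_φ`);
* `C k : Fin 12 → Fin 4` — the orbit of lines through `y_k` containing the vertices of triangle `i` (POINT side; fibres = cycles of `q_k`);
* `β k j : Fin 4 → Fin 4` — the orbit on `m_j` met by the line orbit `(k, t)` through `y_k` (a bijection).
`IsFlagTenOrbitMatrix` is the conjunction of the `λ = 1` equations of the orbit matrix, pair type by pair type (designs g12 FAMILY-FLAG7 §1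
(R1)(R2)(R3)(C1)(C3)(C4) with `ρ = 1`; = designs g11 FAMILY-FLAG10 §3 (Oa)–(Oe)). Every such collineation yields data satisfying it
(`FlagTenOrbitReduction`, TYPED here, not proved in the kernel: the orbit indexing is bookkeeping the cell has not formalised), so
`NoFlagTenOrbitMatrix → NoFlagOrder3Order12Fixed 10` given the reduction (`noFlagTen_of_orbitReduction`, pure logic).

CENSUS STATUS (2026-08-22, outside the kernel): `NoFlagTenOrbitMatrix` is asserted by exact computation — designs g11 (C enumeration of the
1,246,328 line sides in 12,184 `Cent(φ)`-classes over the nine cycle types of `φ`, C/Python point side: no orbit matrix) and the designs g12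
replication (independent derivation of the equations, independent C enumeration and canonicalizer, independent Python point side; per-class
point-side counts identical on all 12,184 classes; see HOME REPLICATION-FLAG10.md for the final status of the line-side counts). Nothing in this
file depends on that computation; the statements are typed so that the census row names a precise proposition. A positive control of the same
equations one order down (n = 9, seven fixed points) does have orbit matrices (designs g12 FAMILY-FLAG7 §4), so the proposition is not vacuous
by shape. No `sorry`, no new axioms.
-/

namespace Summit.Ventures.DiscreteObjects.PP12

open Configuration Finset
open scoped Classical

/-- A colouring `c : Fin 12 → Fin 4` whose four fibres have size 3 and contain no `φ`-adjacent pair: a triangle factor of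
`K₁₂ − C_φ` (`C_φ` = the 2-regular graph `{i, φ i}`). -/
def IsTriangleColouring (φ : Equiv.Perm (Fin 12)) (c : Fin 12 → Fin 4) : Prop :=
  (∀ t : Fin 4, (univ.filter fun i : Fin 12 => c i = t).card = 3) ∧ ∀ i : Fin 12, c (φ i) ≠ c i

/-- The finite data of the orbit matrix of the `f = 10` flag sub-cell (see the module docstring for the meaning of the fields). -/
structure FlagTenOrbitData where
  /-- triangle `i` is inscribed in triangle `φ i` -/
  φ : Equiv.Perm (Fin 12)
  /-- line side: `γ j i` = orbit on the fixed line `m_j` met by the sides of triangle `i` -/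
  γ : Fin 9 → Fin 12 → Fin 4
  /-- point side: `C k i` = orbit of lines through the fixed point `y_k` containing the vertices of triangle `i` -/
  C : Fin 9 → Fin 12 → Fin 4
  /-- `β k j t` = orbit on `m_j` met by the line orbit `(k, t)` through `y_k` -/
  β : Fin 9 → Fin 9 → Fin 4 → Fin 4

/-- Indicator of a proposition as a natural number (local helper). -/
noncomputable def flagInd (p : Prop) : ℕ := if p then 1 else 0

/-- **The orbit-matrix equations of the `f = 10` flag sub-cell** (all `λ = 1` conditions summed over `σ`-orbits; FAMILY-FLAG7 §1 /
FAMILY-FLAG10 §3). In order: `φ` fixed-point-free without 2-cycles; line side and point side are triangle factors of `K₁₂ − C_φ`;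
the `β k j` are bijections; (R1) two side-orbits meet correctly ⇔ the X-words `γ · i`, `γ · i'` agree in exactly 2 coordinates for
non-adjacent `i ≠ i'` and in 0 for adjacent ones; (C1)=(Oa) dually for the point side `C`; (R2)=(Od) side-orbit `i` against line orbit
`(k,t)`: `#{j : β k j t = γ j i} = 3 − 2[C k i = t] − [C k (φ⁻¹ i) = t]`; (R3)=(Oe) two line orbits through different fixed points;
(C3)=(Ob) exterior orbit `i` against the orbit `(j,t)` on `m_j`: `#{k : β k j (C k i) = t} = 3 − 2[γ j i = t] − [γ j (φ i) = t]`;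
(C4)=(Oc) two orbits on different fixed lines. -/
def IsFlagTenOrbitMatrix (D : FlagTenOrbitData) : Prop :=
  (∀ i : Fin 12, D.φ i ≠ i ∧ D.φ (D.φ i) ≠ i) ∧
  (∀ j : Fin 9, IsTriangleColouring D.φ (D.γ j)) ∧
  (∀ k : Fin 9, IsTriangleColouring D.φ (D.C k)) ∧
  (∀ k j : Fin 9, Function.Bijective (D.β k j)) ∧
  (∀ i i' : Fin 12, i ≠ i' →
    (univ.filter fun j : Fin 9 => D.γ j i = D.γ j i').card = (if D.φ i = i' ∨ D.φ i' = i then 0 else 2)) ∧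
  (∀ i i' : Fin 12, i ≠ i' →
    (univ.filter fun k : Fin 9 => D.C k i = D.C k i').card = (if D.φ i = i' ∨ D.φ i' = i then 0 else 2)) ∧
  (∀ (k : Fin 9) (t : Fin 4) (i : Fin 12),
    (univ.filter fun j : Fin 9 => D.β k j t = D.γ j i).card + 2 * flagInd (D.C k i = t) + flagInd (D.C k (D.φ.symm i) = t) = 3) ∧
  (∀ (k k' : Fin 9) (t t' : Fin 4), k ≠ k' →
    (univ.filter fun i : Fin 12 => D.C k i = t ∧ D.C k' i = t').card +
      (univ.filter fun j : Fin 9 => D.β k j t = D.β k' j t').card = 3) ∧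
  (∀ (i : Fin 12) (j : Fin 9) (t : Fin 4),
    (univ.filter fun k : Fin 9 => D.β k j (D.C k i) = t).card + 2 * flagInd (D.γ j i = t) + flagInd (D.γ j (D.φ i) = t) = 3) ∧
  (∀ (j j' : Fin 9) (t t' : Fin 4), j ≠ j' →
    (univ.filter fun i : Fin 12 => D.γ j i = t ∧ D.γ j' i = t').card +
      (univ.filter fun p : Fin 9 × Fin 4 => D.β p.1 j p.2 = t ∧ D.β p.1 j' p.2 = t').card = 3)

/-- **Census statement at the orbit level (typed; decided EMPTY by computation OUTSIDE the kernel, designs g11 + g12, 2026-08-22):**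
no orbit matrix of the `f = 10` flag sub-cell exists. -/
def NoFlagTenOrbitMatrix : Prop := ∀ D : FlagTenOrbitData, ¬ IsFlagTenOrbitMatrix D

/-- **Census statement (typed, NOT proved): the orbit-matrix reduction of the `f = 10` flag sub-cell.** Every projective plane of order 12
with a collineation `σ ≠ 1`, `σ³ = 1`, of flag type with exactly 10 fixed points yields orbit-matrix data satisfying
`IsFlagTenOrbitMatrix` (designs g12 FAMILY-FLAG7 §0–§2: index the exterior orbit-triangles by `Fin 12` via the non-fixed line `u₀ ∋ c`,
the fixed points `≠ c` and the fixed lines `≠ l` by `Fin 9`, the four non-trivial orbits on each `m_j` / through each `y_k` by `Fin 4`,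
and read the entries of the tactical decomposition; the kernel covers the structure up to the odd-point permutation — `FlagExterior`,
`FlagTenOddPoint` — but not this indexing). -/
def FlagTenOrbitReduction : Prop :=
  ∀ (P L : Type) [Membership P L] [Fintype P] [Fintype L] [ProjectivePlane P L],
    ProjectivePlane.order P L = 12 → ∀ σ : Collineation P L, σ.onPoints ^ 3 = 1 → σ.onPoints ≠ 1 →
      (∃ (l : L) (c : P), σ.onLines l = l ∧ σ.onPoints c = c ∧ c ∈ l ∧
          (∀ p : P, σ.onPoints p = p → p ∈ l) ∧ (∀ m : L, σ.onLines m = m → c ∈ m) ∧ fixedCard σ.onPoints = 10) →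
      ∃ D : FlagTenOrbitData, IsFlagTenOrbitMatrix D

/-- **How the census uses the orbit level:** if the reduction holds and no orbit matrix exists, the sub-cell `f = 10` is empty
(`NoFlagOrder3Order12Fixed 10`). Pure logic; records the exact finite proposition the two computations assert. -/
theorem noFlagTen_of_orbitReduction (hred : FlagTenOrbitReduction) (hno : NoFlagTenOrbitMatrix) :
    NoFlagOrder3Order12Fixed 10 := by
  intro P L _ _ _ _ h12 σ hq hne hflag
  obtain ⟨D, hD⟩ := hred P L h12 σ hq hne hflag
  exact hno D hD

/-- Sanity of the encoding (line side): under `IsFlagTenOrbitMatrix` two `φ`-adjacent triangles are separated by every `γ j`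
(the fibres of `γ j` are triangles of `K₁₂ − C_φ`), read off from (R1) with `i' = φ i`. -/
theorem IsFlagTenOrbitMatrix.gamma_separates {D : FlagTenOrbitData} (h : IsFlagTenOrbitMatrix D) (j : Fin 9) (i : Fin 12) :
    D.γ j (D.φ i) ≠ D.γ j i :=
  (h.2.1 j).2 i

/-- Sanity of the encoding (point side): dually, `C k` separates `φ`-adjacent triangles. -/
theorem IsFlagTenOrbitMatrix.C_separates {D : FlagTenOrbitData} (h : IsFlagTenOrbitMatrix D) (k : Fin 9) (i : Fin 12) :
    D.C k (D.φ i) ≠ D.C k i :=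
  (h.2.2.1 k).2 i

end Summit.Ventures.DiscreteObjects.PP12
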